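import Summits.CriticalPhenomena.PercolationContinuityZ3.Theorems.PercNearOneGluingNoHeavyQuantTargetPropertyThinAt
import Summits.CriticalPhenomena.PercolationContinuityZ3.Theorems.PercNearOneGluingNoHeavyQuantEffectiveTargetLemma
import Literature.Probability.Percolation.KozmaNitzanCorridor
import HarnessLib

/-!
# QUANT lane (R2): Kozma–Nitzan's Lemma 10 for transversally bounded subboxes from BOUNDED-RANGE hittability

builds on p205010 (kernel theorem, internal audit signed; external expert review pending)

Cell `prim-quant` (post-continuity programme, LANE 1), seat `prim-quant-p2` (METHOD = effective Kozma–Nitzan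
reduction), memo `run/shared/lean/prim/quant/P2-EFFECTIVE-KN.md` §1–§3.

`Quant.targetLemma_additive_core` (file `…QuantEffectiveTargetLemma.lean`) proves the additive Lemma 10 for targets
whose routes have scales in a bounded range `[R, ℓhi]`, from hittability of the geometries on `[ℓmax, ℓhi]`.  Here the
route bound is derived from the SHAPE of the subbox instead: if `D` lies in a slab of transversal half-width `w` and
every geometry of `H` has, avoiding any one axis, a coordinate in which `Q` has extent `≥ 2` (`Quant.WideList H`;
true for the quarter faces in `d ≥ 2` and the elongated boxes in `d ≥ 3`), then every route `v + ℓQ ⊆ D` has `ℓ ≤ w`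
(`Quant.route_scale_le_of_thin`).  Hence

* `Quant.targetLemma_thin` — under the scale-indexed hypotheses (a) on the BOUNDED range `[ℓmax, w]`, (b), (c), (d),
  (e) of `targetLemma_additive_core`: `∀ δ', TargetPropertyThinAt d p (δ' + 6δ) δ' H R w`;
* `Quant.wideList_qfList`, `Quant.wideList_elongList` — the two geometry families of KN §4 qualify.

No sorries; standard axioms.  [cite: KozmaNitzan2024, §4 Lemma 10 (pp. 17–22), p. 16 (geometries)]
-/

noncomputable section

namespace Summit.CriticalPhenomena.PercolationContinuityZ3.Theorems.Quant

open MeasureTheory Literature.Probability.LatticeModels Literature.Probability.Percolation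
  Literature.Probability.Percolation.KozmaNitzan

variable {d : ℕ}

/-- **A wide family of geometries**: for every geometry `g` of `H`, `Q_g` is a genuine box (`loQ ≤ hiQ`) and,
whatever axis `a` is excluded, some other coordinate `i ≠ a` has `Q`-extent at least `2` (`loQ i + 2 ≤ hiQ i`).
Stated as a hypothesis shape (not a definition).  Quarter faces (`Q = [-1,1]^d`, `d ≥ 2`) and elongated boxes
(`Q = [-1,K] × [-1,1]^{d-1}`, `d ≥ 3`) are wide. [cite: KozmaNitzan2024, §4 p. 16 and Lemma 11 (p. 22)] -/
theorem route_scale_le_of_thin {g : Geom d} (hle : g.loQ ≤ g.hiQ)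
    {a i : Fin d} (hia : i ≠ a) (hwide : g.loQ i + 2 ≤ g.hiQ i)
    {D : Finset (Site d)} {c : Site d} {w : ℕ}
    (hD : ∀ y ∈ D, ∀ j : Fin d, j ≠ a → c j - (w : ℤ) ≤ y j ∧ y j ≤ c j + (w : ℤ))
    {ℓ : ℕ} {v : Site d} (hQ : g.Qset ℓ v ⊆ D) : ℓ ≤ w := by
  -- the two corners of `v + ℓQ` lie in `D`
  have hcorner : ∀ z : Site d, (∀ j, v j + (ℓ : ℤ) * g.loQ j ≤ z j ∧ z j ≤ v j + (ℓ : ℤ) * g.hiQ j) → z ∈ D := by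
    intro z hz
    refine hQ ?_
    rw [Geom.Qset, mem_Icc_iff]
    intro j
    simpa only [Pi.add_apply, Pi.smul_apply, smul_eq_mul] using hz j
  have hℓ0 : (0 : ℤ) ≤ ℓ := by positivity
  have hlo : (fun j => v j + (ℓ : ℤ) * g.loQ j) ∈ D := hcorner _ fun j =>
    ⟨le_rfl, by have := hle j; nlinarith⟩
  have hhi : (fun j => v j + (ℓ : ℤ) * g.hiQ j) ∈ D := hcorner _ fun j =>
    ⟨by have := hle j; nlinarith, le_rfl⟩
  have h1 := (hD _ hlo i hia).1
  have h2 := (hD _ hhi i hia).2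
  have : (ℓ : ℤ) * 2 ≤ 2 * w := by nlinarith
  exact_mod_cast (by linarith : (ℓ : ℤ) ≤ w)

/-- **Quarter faces are wide** (`d ≥ 2`): `Q = [-1,1]^d`. [cite: KozmaNitzan2024, §4 Lemma 9 (p. 16)] -/
theorem wideList_qfList (hd : 2 ≤ d) :
    ∀ g ∈ qfList d, g.loQ ≤ g.hiQ ∧ ∀ a : Fin d, ∃ i : Fin d, i ≠ a ∧ g.loQ i + 2 ≤ g.hiQ i := by
  intro g hg
  rw [qfList, List.mem_map] at hg
  obtain ⟨x, -, rfl⟩ := hg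
  refine ⟨fun j => by simp [qfGeom], fun a => ?_⟩
  haveI : NeZero d := ⟨by omega⟩
  obtain ⟨i, hi⟩ : ∃ i : Fin d, i ≠ a := by
    by_cases ha : a = 0
    · exact ⟨⟨1, by omega⟩, fun h => by rw [ha] at h; exact absurd (congrArg Fin.val h) (by simp)⟩
    · exact ⟨0, fun h => ha h.symm⟩
  exact ⟨i, hi, by simp [qfGeom]⟩

/-- **Elongated boxes are wide** (`d ≥ 3`): `Q = [-1,K] × [-1,1]^{d-1}` has extent `2` in every transversal
direction, and in `d ≥ 3` two transversal directions avoid any given axis. [cite: KozmaNitzan2024, §4 Lemma 11 (p. 22)] -/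
theorem wideList_elongList (hd : 3 ≤ d) (K : ℕ) (hK : 1 ≤ K) :
    ∀ g ∈ elongList d K hK, g.loQ ≤ g.hiQ ∧ ∀ a : Fin d, ∃ i : Fin d, i ≠ a ∧ g.loQ i + 2 ≤ g.hiQ i := by
  intro g hg
  rw [elongList, List.mem_map] at hg
  obtain ⟨x, -, rfl⟩ := hg
  have hσ := units_sign x.2
  have hK' : (1 : ℤ) ≤ K := by exact_mod_cast hK
  refine ⟨fun j => ?_, fun a => ?_⟩
  · simp only [elongGeom, sLo, sHi, Pi.zero_apply, zero_add, zero_sub]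
    by_cases hj : j = x.1
    · simp only [hj, if_true]
      rcases hσ with h | h
      · simp only [h, if_true]; linarith
      · simp only [h, show (-1 : ℤ) ≠ 1 by norm_num, if_false]; linarith
    · simp only [hj, if_false]; norm_num
  · -- two indices different from `x.1`; one of them differs from `a`
    obtain ⟨i, hi1, hia⟩ : ∃ i : Fin d, i ≠ x.1 ∧ i ≠ a := by
      have h3 : 3 ≤ Fintype.card (Fin d) := by simpa using hd
      obtain ⟨i, hi⟩ : ∃ i : Fin d, i ∉ ({x.1, a} : Finset (Fin d)) := by
        by_contra hall
        push Not at hall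
        have : (Finset.univ : Finset (Fin d)) ⊆ {x.1, a} := fun i _ => hall i
        have := (Finset.card_le_card this).trans (Finset.card_le_two)
        rw [Finset.card_univ] at this
        omega
      simp only [Finset.mem_insert, Finset.mem_singleton, not_or] at hi
      exact ⟨i, hi.1, hi.2⟩
    refine ⟨i, hia, ?_⟩
    simp only [elongGeom, sLo, sHi, hi1, if_false, Pi.zero_apply, zero_sub, zero_add]
    norm_num

/-- **Kozma–Nitzan's Lemma 10 for transversally bounded subboxes, from bounded-range hittability.**  Under the
hypotheses of `targetLemma_additive_core` with (a) on the range `[ℓmax, w]` only, and for a wide family `H`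
(`loQ ≤ hiQ`, and off any axis a coordinate of `Q`-extent `≥ 2`), the linear family
`∀ δ', TargetPropertyThinAt d p (δ' + 6δ) δ' H R w` holds: a route `v + ℓQ ⊆ D` in a subbox of transversal
half-width `w` has `ℓ ≤ w` (`route_scale_le_of_thin`), so only scales `ℓ ≤ w` are ever needed.
builds on p205010 (kernel theorem, internal audit signed; external expert review pending).
[cite: KozmaNitzan2024, §4 Lemma 10 (pp. 17–22)] -/
theorem targetLemma_thin [NeZero d] (p : unitInterval) (hp1 : (p : ℝ) < 1)
    {δ : ℝ} (hδ : 0 < δ) (H : List (Geom d))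
    (hH : ∀ g ∈ H, g.loQ ≤ g.hiQ ∧ ∀ a : Fin d, ∃ i : Fin d, i ≠ a ∧ g.loQ i + 2 ≤ g.hiQ i)
    {m M ℓmax k R w : ℕ} (hmM : m < M)
    (hhit : ∀ g ∈ H, ∀ ℓ : ℕ, ℓmax ≤ ℓ → ℓ ≤ w →
      1 - δ ^ 2 < (bondPercolation (zdGraph d) p).real (linkIn (↑(g.Qset ℓ 0)) (box d m) (g.Fset ℓ 0)))
    (hface : ∀ (a : Fin d) (τ : Fin d → ℤˣ),
      1 - δ ^ 2 < (bondPercolation (zdGraph d) p).real (linkEvent (box d m) (orthantFace a τ M) M))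
    (huniq : 1 - δ ^ 2 < (bondPercolation (zdGraph d) p).real (uniqZone m M))
    (hk : (1 - (p : ℝ) ^ seedBound d M) ^ k ≤ δ)
    (hR : 3 * M + ℓmax + 4 + ⌈(1 / (1 - (p : ℝ)) ^ (2 * d * LData.Ncont d M k)) / δ⌉₊ ≤ R) (δ' : ℝ) :
    TargetPropertyThinAt d p (δ' + 6 * δ) δ' H R w := by
  intro W Sfin D lo hi T o hfin hsub hDS ho hoD hthin hBR htgt hTD hTne hreach
  obtain ⟨a, c, hD⟩ := hthin
  have h := targetLemma_additive_core p hp1 hδ H (ℓhi := w) hmM hhit hface huniq hk hR W Sfin D lo hi T o hfin hsub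
    hDS ho hoD hBR (fun v hv => ?_) hTD hTne
  · linarith
  obtain ⟨ℓ, hRℓ, g, hg, hQ, hF⟩ := htgt.hit v hv
  obtain ⟨hle, hwide⟩ := hH g hg
  obtain ⟨i, hia, hi⟩ := hwide a
  exact ⟨ℓ, hRℓ, route_scale_le_of_thin hle hia hi hD hQ, g, hg, hQ, hF⟩

end Summit.CriticalPhenomena.PercolationContinuityZ3.Theorems.Quant

end
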